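import Mathlib
import Summits.ValiantsHypothesis.ValiantsHypothesis.Theorems.BarrierLeverPartitionMinorsHitByVPDownCompression
import Summits.ValiantsHypothesis.ValiantsHypothesis.Theorems.BarrierLeverPartitionMinorsHitByVPDownCompressionPass

/-!
# Route BarrierLever — item `PartitionMinorsHitByVP` (stmt-ValiantsHypothesis-19717), line `hidden_states`:
# LOWER SETS SUFFICE FOR EVERY HIDDEN-STATE DESIGN — a design good for all down-sets is good for all injective row families

Helper file (`--supports stmt-ValiantsHypothesis-19717`; cell valiant-natproofs, rung V4, 𝒟-side door (c), registered line
`Cruxes/PartitionMinorsHitByVP/Lines/hidden_states.lean` v8; prover seat val-np-p6 gen 15). Definition-free; closes NO item.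

THE THEOREM (`good_of_lower`). Fix ANY design `e : Fin r → Fin m × Finset (Fin K)` (pieces, state sets — no threshold, join or
injectivity hypothesis is used). If for every injective row family `v : Fin r → Finset (Fin h)` whose range is a LOWER SET some table
`tx` makes the block-additive matrix `[∏_{c ∈ v i} (tx (e k).1 none c + Σ_{q ∈ (e k).2} tx (e k).1 (some q) c)]_{i,k}` nonsingular, then
the same holds for EVERY injective row family `u`. One-piece form: `good_of_lower_onePiece`.

PROOF (translation = down-compression). Adding a scalar `t` to the base coordinate `a` of EVERY piece (`tx p none a ↦ tx p none a + t`)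
translates every hidden point by `t·e_a`, so the row of the monomial `x^{u i}` becomes `row(u i) + t·[a ∈ u i]·row(u i ∖ a)`: the
translated matrix is `A + t•B` where a row `u i ∋ a` whose shadow `u i ∖ a` is itself a row («blocked») has `B`-row equal to that
`A`-row, and a row `u i ∋ a` whose shadow is not a row («moved») has `B`-row = the row of the shadow. By val-np-p1 g12's matrix lemma
`DownCompression.det_ne_zero_of_rowCompression` (p542445's part 1; top `t`-coefficient after subtracting `t·` the partner row from
every blocked row) `A + t•B` is nonsingular for some `t` as soon as «`B` on the moved rows, `A` elsewhere» — which is EXACTLY the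
matrix of the DOWN-COMPRESSED family `𝓓_a u` at the same table — is nonsingular (`step`). One pass `𝓓_{h−1}, …, 𝓓_0` reaches a family
with lower-set range (`DownCompression.isComp_of_compOf`, `isComp_of_compOf_of_isComp`, `isLowerSet_range_of_isComp`,
`injective_of_compOf`, p1 g12's Mathlib-only pass file), so the hypothesis applies there and `h` translation steps walk back (`iterate`).
This is the node-level twin of p1 g12's witness-level lower-set reduction of the crux (`…PartitionMinorsHitByVPOfLowerSets`, which
multiplies the witness by `1 + t x_a`); here nothing is multiplied — the table's base point absorbs the move, so budgets `(m, K)`,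
thresholds and the design are untouched.

CONSEQUENCES (companion file `…HiddenStatesLowerToAllCells`): the registered all-`u` node `Stmt.stub_universalJoinWide` is
EQUIVALENT to the lower node `LowerNode.Stmt.universalJoinWideLower` (p599518); conjecture MDS½ (p647354) is EQUIVALENT to GC½
(p636831); every kernel cell of the lower node (every `(h ≤ 19, r ≤ 2^h)`, p642534; `h = 20`, `r ≤ 547 542` and `r ≥ 1 032 614`,
p646542) is a cell of the registered node, so the first open window of the REGISTERED node is `h = 20`, `547 543 ≤ r ≤ 1 032 613`.

WHAT THIS IS NOT: no design is proved good here; item 19717 stays OPEN; nothing on crux 14610 or VP ≠ VNP.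
-/

set_option linter.dupNamespace false

namespace Summit.ValiantsHypothesis.ValiantsHypothesis.Theorems.BarrierLever.HiddenStates

open Finset

namespace LowerToAll

variable {h m K r : ℕ}

/-- Translating one coordinate of a monomial's argument: `∏_{c ∈ S} (P c + t·[c = a]) = ∏_{c ∈ S} P c + t·[a ∈ S]·∏_{c ∈ S ∖ a} P c`. -/
theorem prod_add_ite_eq (S : Finset (Fin h)) (a : Fin h) (P : Fin h → ℂ) (t : ℂ) :
    ∏ c ∈ S, (P c + if c = a then t else 0) =
      ∏ c ∈ S, P c + t * (if a ∈ S then ∏ c ∈ S.erase a, P c else 0) := by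
  have hrest : ∏ c ∈ S.erase a, (P c + if c = a then t else 0) = ∏ c ∈ S.erase a, P c :=
    Finset.prod_congr rfl fun c hc => by rw [if_neg (Finset.ne_of_mem_erase hc), add_zero]
  by_cases ha : a ∈ S
  · rw [if_pos ha, ← Finset.mul_prod_erase S (fun c => P c + if c = a then t else 0) ha,
      ← Finset.mul_prod_erase S P ha, hrest, if_pos rfl]
    ring
  · rw [if_neg ha, mul_zero, add_zero]
    refine Finset.prod_congr rfl fun c hc => ?_
    have hca : c ≠ a := fun hca => ha (hca ▸ hc)
    rw [if_neg hca, add_zero]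

/-- **One compression step.** `v` is the down-compression `𝓓_a u` (hypotheses `hv₁ / hv₂`, spelled out as in p1 g12's pass file).
If the design `e` is good for `v` at the table `tx`, then it is good for `u` at the table obtained from `tx` by adding one scalar
`t` to the base coordinate `a` of every piece. -/
theorem step (e : Fin r → Fin m × Finset (Fin K)) (u v : Fin r → Finset (Fin h)) (a : Fin h)
    (hv₁ : ∀ i, a ∈ u i → (∀ k, u k ≠ (u i).erase a) → v i = (u i).erase a)
    (hv₂ : ∀ i, ¬ (a ∈ u i ∧ ∀ k, u k ≠ (u i).erase a) → v i = u i)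
    (tx : Fin m → Option (Fin K) → Fin h → ℂ)
    (hdet : (Matrix.of fun i k : Fin r =>
      ∏ c ∈ v i, (tx (e k).1 none c + ∑ q ∈ (e k).2, tx (e k).1 (some q) c)).det ≠ 0) :
    ∃ t : ℂ, (Matrix.of fun i k : Fin r =>
      ∏ c ∈ u i, ((tx (e k).1 none c + if c = a then t else 0) + ∑ q ∈ (e k).2, tx (e k).1 (some q) c)).det ≠ 0 := by
  classical
  -- the hidden points' coordinates
  set P : Fin r → Fin h → ℂ := fun k c => tx (e k).1 none c + ∑ q ∈ (e k).2, tx (e k).1 (some q) c with hP_def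
  -- the pencil `A + t•B`
  set A : Matrix (Fin r) (Fin r) ℂ := Matrix.of fun i k => ∏ c ∈ u i, P k c with hA_def
  set B : Matrix (Fin r) (Fin r) ℂ :=
    Matrix.of fun i k => if a ∈ u i then ∏ c ∈ (u i).erase a, P k c else 0 with hB_def
  -- moved rows, blocked rows, partners
  let mv : Fin r → Prop := fun i => a ∈ u i ∧ ∀ k, u k ≠ (u i).erase a
  let bl : Fin r → Prop := fun i => a ∈ u i ∧ ∃ k, u k = (u i).erase a
  let partner : Fin r → Fin r := fun i => if hi : ∃ k, u k = (u i).erase a then hi.choose else i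
  have hpartner : ∀ i, (∃ k, u k = (u i).erase a) → u (partner i) = (u i).erase a := by
    intro i hi
    simp only [partner, dif_pos hi]
    exact hi.choose_spec
  have h0 : ∀ i, ¬ mv i → ¬ bl i → ∀ j, B i j = 0 := by
    intro i hm hb j
    have hai : a ∉ u i := by
      intro hai
      by_cases hk : ∃ k, u k = (u i).erase a
      · exact hb ⟨hai, hk⟩
      · push Not at hk
        exact hm ⟨hai, hk⟩
    rw [hB_def, Matrix.of_apply, if_neg hai]
  have hbl : ∀ i, bl i → (∀ j, B i j = A (partner i) j) ∧ ¬ mv (partner i) ∧ ¬ bl (partner i) := by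
    intro i hi
    have hpu := hpartner i hi.2
    have hna : a ∉ u (partner i) := by rw [hpu]; exact Finset.notMem_erase a _
    refine ⟨fun j => ?_, fun hm => hna hm.1, fun hb => hna hb.1⟩
    rw [hB_def, hA_def, Matrix.of_apply, Matrix.of_apply, if_pos hi.1, hpu]
  have hdisj : ∀ i, ¬ (mv i ∧ bl i) := by
    rintro i ⟨⟨_, hm⟩, ⟨_, ⟨k, hk⟩⟩⟩
    exact hm k hk
  have hdet' : (Matrix.of fun i j => if mv i then B i j else A i j).det ≠ 0 := by
    have hmat : (Matrix.of fun i j => if mv i then B i j else A i j) =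
        Matrix.of fun i k : Fin r => ∏ c ∈ v i, P k c := by
      ext i k
      rw [Matrix.of_apply, Matrix.of_apply]
      by_cases hi : mv i
      · rw [if_pos hi, hB_def, Matrix.of_apply, if_pos hi.1, hv₁ i hi.1 hi.2]
      · rw [if_neg hi, hA_def, Matrix.of_apply, hv₂ i hi]
    rw [hmat]
    exact hdet
  obtain ⟨t, ht⟩ := DownCompression.det_ne_zero_of_rowCompression A B mv bl partner h0 hbl hdisj hdet'
  refine ⟨t, ?_⟩
  have hmat : (Matrix.of fun i k : Fin r =>
      ∏ c ∈ u i, ((tx (e k).1 none c + if c = a then t else 0) + ∑ q ∈ (e k).2, tx (e k).1 (some q) c)) =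
      Matrix.of fun i j => A i j + t * B i j := by
    ext i k
    rw [Matrix.of_apply, Matrix.of_apply, hA_def, hB_def, Matrix.of_apply, Matrix.of_apply,
      ← prod_add_ite_eq (u i) a (P k) t]
    refine Finset.prod_congr rfl fun c _ => ?_
    rw [hP_def]
    ring
  rw [hmat]
  exact ht

/-- **The pass** (induction on the number `n` of compressed coordinates, top coordinate first, as in p1 g12's `iterate_x`):
if the design is good for every injective lower family, it is good for every injective family that is `a`-compressed in every
coordinate `a` with `a + n < h`. -/
theorem iterate (e : Fin r → Fin m × Finset (Fin K))
    (hyp : ∀ v : Fin r → Finset (Fin h), Function.Injective v → IsLowerSet (Set.range v) →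
      ∃ tx : Fin m → Option (Fin K) → Fin h → ℂ,
        (Matrix.of fun i k : Fin r =>
          ∏ c ∈ v i, (tx (e k).1 none c + ∑ q ∈ (e k).2, tx (e k).1 (some q) c)).det ≠ 0) :
    ∀ n : ℕ, n ≤ h → ∀ u : Fin r → Finset (Fin h), Function.Injective u →
      (∀ a : Fin h, a.val + n < h → ∀ i, a ∈ u i → ∃ k, u k = (u i).erase a) →
      ∃ tx : Fin m → Option (Fin K) → Fin h → ℂ,
        (Matrix.of fun i k : Fin r =>
          ∏ c ∈ u i, (tx (e k).1 none c + ∑ q ∈ (e k).2, tx (e k).1 (some q) c)).det ≠ 0 := by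
  classical
  intro n
  induction n with
  | zero =>
    intro _ u hu hcomp
    exact hyp u hu
      (DownCompression.isLowerSet_range_of_isComp u (fun a i hai => hcomp a (by have := a.isLt; omega) i hai))
  | succ n ih =>
    intro hn u hu hcomp
    -- compress the coordinate `a₀ = h - (n + 1)`
    set a₀ : Fin h := ⟨h - (n + 1), by omega⟩ with ha₀_def
    let v : Fin r → Finset (Fin h) := fun i =>
      if a₀ ∈ u i ∧ ∀ k, u k ≠ (u i).erase a₀ then (u i).erase a₀ else u i
    have hv₁ : ∀ i, a₀ ∈ u i → (∀ k, u k ≠ (u i).erase a₀) → v i = (u i).erase a₀ :=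
      fun i h1 h2 => by simp only [v, if_pos (And.intro h1 h2)]
    have hv₂ : ∀ i, ¬ (a₀ ∈ u i ∧ ∀ k, u k ≠ (u i).erase a₀) → v i = u i :=
      fun i h1 => by simp only [v, if_neg h1]
    have hv_inj : Function.Injective v := DownCompression.injective_of_compOf u v a₀ hu hv₁ hv₂
    have hv_comp : ∀ a : Fin h, a.val + n < h → ∀ i, a ∈ v i → ∃ k, v k = (v i).erase a := by
      intro a ha
      by_cases haa : a = a₀
      · subst haa
        exact DownCompression.isComp_of_compOf u v _ hv₁ hv₂
      · have ha' : a.val + (n + 1) < h := by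
          have : a.val ≠ h - (n + 1) := fun hv => haa (Fin.ext (by rw [hv, ha₀_def]))
          omega
        exact DownCompression.isComp_of_compOf_of_isComp u v a a₀ (hcomp a ha') hv₁ hv₂
    obtain ⟨tx, htx⟩ := ih (by omega) v hv_inj hv_comp
    obtain ⟨t, ht⟩ := step e u v a₀ hv₁ hv₂ tx htx
    refine ⟨fun p o c => match o with
      | none => tx p none c + (if c = a₀ then t else 0)
      | some q => tx p (some q) c, ?_⟩
    exact ht

/-- **LOWER SETS SUFFICE (any design).** If a design is good — some table makes the block-additive matrix nonsingular — for every
injective row family with lower-set range, then it is good for every injective row family. -/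
theorem good_of_lower (e : Fin r → Fin m × Finset (Fin K))
    (hyp : ∀ v : Fin r → Finset (Fin h), Function.Injective v → IsLowerSet (Set.range v) →
      ∃ tx : Fin m → Option (Fin K) → Fin h → ℂ,
        (Matrix.of fun i k : Fin r =>
          ∏ c ∈ v i, (tx (e k).1 none c + ∑ q ∈ (e k).2, tx (e k).1 (some q) c)).det ≠ 0)
    (u : Fin r → Finset (Fin h)) (hu : Function.Injective u) :
    ∃ tx : Fin m → Option (Fin K) → Fin h → ℂ,
      (Matrix.of fun i k : Fin r =>
        ∏ c ∈ u i, (tx (e k).1 none c + ∑ q ∈ (e k).2, tx (e k).1 (some q) c)).det ≠ 0 :=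
  iterate e hyp h le_rfl u hu (fun a ha => absurd ha (by omega))

/-- **LOWER SETS SUFFICE (one piece).** The same for a one-piece design `cols : Fin r → Finset (Fin K)` with a piece-free table
`tx : Option (Fin K) → Fin h → ℂ` (the shape of the GC½ / MDS½ hypotheses, p636831 / p647354). -/
theorem good_of_lower_onePiece (cols : Fin r → Finset (Fin K))
    (hyp : ∀ v : Fin r → Finset (Fin h), Function.Injective v → IsLowerSet (Set.range v) →
      ∃ tx : Option (Fin K) → Fin h → ℂ,
        (Matrix.of fun i k : Fin r => ∏ c ∈ v i, (tx none c + ∑ q ∈ cols k, tx (some q) c)).det ≠ 0)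
    (u : Fin r → Finset (Fin h)) (hu : Function.Injective u) :
    ∃ tx : Option (Fin K) → Fin h → ℂ,
      (Matrix.of fun i k : Fin r => ∏ c ∈ u i, (tx none c + ∑ q ∈ cols k, tx (some q) c)).det ≠ 0 := by
  have H := good_of_lower (h := h) (m := 1) (fun k => ((0 : Fin 1), cols k)) (fun v hv hl => ?_) u hu
  · obtain ⟨tx, htx⟩ := H
    exact ⟨tx 0, htx⟩
  · obtain ⟨tx, htx⟩ := hyp v hv hl
    exact ⟨fun _ => tx, htx⟩

end LowerToAll

end Summit.ValiantsHypothesis.ValiantsHypothesis.Theorems.BarrierLever.HiddenStates
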